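import Summits.PneNP.PneNP.Theorems.ChebyshevTracialDesignLevelTail
import HarnessLib

/-!
# Cell pnp-psdrank, route `ChebyshevTracialDesign`: the REAL-VARIABLE ESTIMATES of spectral non-tightness (SNT) — head terms
# `≤ 4μν·16^{−κ}`, tail sum `≤ μν/4`

Harmonic backbone of the crux `TracialDecayExp20` (stmt-PneNP-19878), brick 28a (prover g8; step S4 of the `r = 1` rung, MEMO-9 §6 work order;
planner p1 N2-SpreadStructure §SNT (1)). This file is the ANALYSIS half of SNT, with every combinatorial quantity replaced by a real variable, so
that the assembly (next file, `…SpectralNonTightness`) only has to plug in the normalised layer bounds of brick 27 (`…SpectralNonTightnessLayers`):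
* §1 elementary estimates: the tight attenuation `A_κ = Π_{i<κ}(2i+1)/(n−2i) ≤ (4κ/n)^κ`, monotone in `κ`; `√(A·L) ≤ 4μΦ^κ` from `A ≤ a^κ`,
  `L ≤ 16μ²F^{2κ}`, `aF² ≤ Φ²`; `√ν ≤ ν e^{8κ}` outside the Keevash–Lifshitz range `2κ ≤ ⅛ log(1/ν)`; `e ≤ 3`, `e⁸ ≤ 6561`, `e^{2ℓ} ≤ 9^D`;
  `0 ≤ log(1/μ) ≤ ℓ` from `e^{−ℓ} ≤ μ ≤ 1`;
* §2 **head term** (`head_term_abstract`): with `C > 0`, `τ ≥ 1`, `0 < c₀ ≤ min(1, 1/(2736Cτ²))`, `D ≥ 2·10⁸`, `D⁴ ≤ n`, `1 ≤ κ ≤ D+8`,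
  `e^{−c₀D} ≤ μ,ν ≤ 1`, `A ≤ (4κ/n)^κ`, `L ≤ 16μ²F^{2κ}` (`F = 48e(2log(1/μ)/(2κ)+3)`, the slice level-`2κ` inequality), and `T` obeying the
  Keevash–Lifshitz form `|T| ≤ Pν(Cτ²log(1/ν)/(2κ))^κ√(AL)` in the range `2κ ≤ min(⅛log(1/ν), 10⁻⁵n)` and the Parseval form `|T| ≤ P√(νAL)`:
  `|T|/P ≤ 4μν·16^{−κ}` (`Φ = 2κF/D² = 96e(log(1/μ)+3κ)/D²`; inside the range `GΦ ≤ 171Cτ²c₀² ≤ 1/16`, outside `e⁸Φ ≤ 1889568(4D+24)/D² ≤ 1/16`);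
* §3 **tail sum** (`tail_sum_arith`): `c'·√(μν·A_{dq n+9}) ≤ μν/4` for `dq n ≥ 45`, `2(2c'+1) ≤ n`, `μ,ν ≥ e^{−c₀ dq n}`, `c₀ ≤ 1`
  (`16c'²A_m ≤ 256m²(4m/(dq n)⁴)^{m−2} ≤ 9^{−dq n} ≤ e^{−2c₀ dq n} ≤ μν`).
[cite: KeevashLifshitz2023, Thm. 1.8] [cite: ODonnell2014, §9.5] [cite: GodsilMeagher2015, §15.2] [cite: Rothvoss2017, §2 (PDF p. 6)]
Stature: support/instrument (real-analysis bookkeeping). WHAT THIS IS NOT: not SNT, nothing on psd rank, no P-vs-NP content. Supports stmt-PneNP-19878.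
-/

set_option linter.dupNamespace false -- `Summit.PneNP.PneNP.…`: summit = sub-problem (D-0017)

noncomputable section

namespace Summit.PneNP.PneNP.Theorems.ChebyshevTracialDesignSpectralNonTightnessEstimates

open Finset Literature.Combinatorics.Optimization
open Summit.PneNP.PneNP.Theorems.ChebyshevTracialDesignLevelTail

variable {n : ℕ}

/-! ### §1 Elementary estimates: the tight attenuation, square roots, the constants -/

/-- `A_κ = Π_{i<κ}(2i+1)/(n−2i) ≤ (4κ/n)^κ` for `4κ ≤ n` (each factor is `≤ (2κ−1)/(n−2κ+2) ≤ 4κ/n`). [cite: GodsilMeagher2015, §15.2] -/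
theorem atten_le_pow {κ : ℕ} (hκn : 4 * κ ≤ n) :
    ∏ i ∈ range κ, ((2 * i + 1 : ℝ) / ((n : ℝ) - 2 * i)) ≤ ((4 * κ : ℝ) / n) ^ κ := by
  rcases Nat.eq_zero_or_pos κ with rfl | hκpos
  · simp
  have hn : (0 : ℝ) < n := by exact_mod_cast (show 0 < n by omega)
  calc ∏ i ∈ range κ, ((2 * i + 1 : ℝ) / ((n : ℝ) - 2 * i)) ≤ ∏ _i ∈ range κ, ((4 * κ : ℝ) / n) := by
        refine prod_le_prod (fun i hi => (atten_factor_le_one (by have := mem_range.1 hi; omega)).1) fun i hi => ?_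
        have hi' := mem_range.1 hi
        have h1 : ((i : ℕ) : ℝ) + 1 ≤ κ := by exact_mod_cast hi'
        have h2 : (4 * κ : ℝ) ≤ n := by exact_mod_cast hκn
        have hi0 : (0 : ℝ) ≤ i := Nat.cast_nonneg _
        have hpos : (0 : ℝ) < (n : ℝ) - 2 * i := by linarith
        rw [div_le_div_iff₀ hpos hn]
        nlinarith [mul_nonneg (sub_nonneg.2 h1) hn.le, mul_nonneg (sub_nonneg.2 h1) (Nat.cast_nonneg κ),
          mul_nonneg (sub_nonneg.2 h2) (Nat.cast_nonneg κ)]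
    _ = ((4 * κ : ℝ) / n) ^ κ := by rw [prod_const, card_range]

/-- The tight attenuation is non-increasing in `κ` while `4κ ≤ n + 3` (every factor lies in `[0,1]`). [cite: GodsilMeagher2015, §15.2] -/
theorem atten_mono {m κ : ℕ} (hmκ : m ≤ κ) (hκn : 4 * κ ≤ n + 3) :
    ∏ i ∈ range κ, ((2 * i + 1 : ℝ) / ((n : ℝ) - 2 * i)) ≤ ∏ i ∈ range m, ((2 * i + 1 : ℝ) / ((n : ℝ) - 2 * i)) := by
  induction κ, hmκ using Nat.le_induction with
  | base => exact le_refl _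
  | succ k hmk ih =>
    rw [prod_range_succ]
    have hk := atten_factor_le_one (n := n) (i := k) (by omega)
    have h0 : 0 ≤ ∏ i ∈ range k, ((2 * i + 1 : ℝ) / ((n : ℝ) - 2 * i)) :=
      prod_nonneg fun i hi => (atten_factor_le_one (by have := mem_range.1 hi; omega)).1
    calc (∏ i ∈ range k, ((2 * i + 1 : ℝ) / ((n : ℝ) - 2 * i))) * ((2 * k + 1 : ℝ) / ((n : ℝ) - 2 * k))
        ≤ (∏ i ∈ range k, ((2 * i + 1 : ℝ) / ((n : ℝ) - 2 * i))) * 1 := mul_le_mul_of_nonneg_left hk.2 h0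
      _ ≤ ∏ i ∈ range m, ((2 * i + 1 : ℝ) / ((n : ℝ) - 2 * i)) := by rw [mul_one]; exact ih (by omega)

/-- The tight attenuation is nonnegative (`4κ ≤ n + 3`). [cite: GodsilMeagher2015, §15.2] -/
theorem atten_nonneg {κ : ℕ} (hκn : 4 * κ ≤ n + 3) : 0 ≤ ∏ i ∈ range κ, ((2 * i + 1 : ℝ) / ((n : ℝ) - 2 * i)) :=
  prod_nonneg fun i hi => (atten_factor_le_one (by have := mem_range.1 hi; omega)).1

/-- Square-root bookkeeping of the head: `A ≤ a^κ`, `L ≤ 16μ²F^{2κ}` and `a·F² ≤ Φ²` give `√(A·L) ≤ 4μ·Φ^κ`. [cite: ODonnell2014, §9.5] -/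
theorem sqrt_mul_le_of_layer {A L a μ F Φ : ℝ} {κ : ℕ} (hA : A ≤ a ^ κ) (ha : 0 ≤ a) (hL0 : 0 ≤ L)
    (hL : L ≤ 16 * μ ^ 2 * F ^ (2 * κ)) (hμ : 0 ≤ μ) (hΦ : 0 ≤ Φ) (haF : a * F ^ 2 ≤ Φ ^ 2) :
    Real.sqrt (A * L) ≤ 4 * μ * Φ ^ κ := by
  have h1 : A * L ≤ (4 * μ * Φ ^ κ) ^ 2 := by
    calc A * L ≤ a ^ κ * (16 * μ ^ 2 * F ^ (2 * κ)) := mul_le_mul hA hL hL0 (pow_nonneg ha _)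
      _ = 16 * μ ^ 2 * (a * F ^ 2) ^ κ := by rw [mul_pow, pow_mul]; ring
      _ ≤ 16 * μ ^ 2 * (Φ ^ 2) ^ κ := by
          have : (a * F ^ 2) ^ κ ≤ (Φ ^ 2) ^ κ := pow_le_pow_left₀ (by positivity) haF κ
          exact mul_le_mul_of_nonneg_left this (by positivity)
      _ = (4 * μ * Φ ^ κ) ^ 2 := by rw [← pow_mul, mul_comm 2 κ, pow_mul]; ring
  calc Real.sqrt (A * L) ≤ Real.sqrt ((4 * μ * Φ ^ κ) ^ 2) := Real.sqrt_le_sqrt h1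
    _ = 4 * μ * Φ ^ κ := Real.sqrt_sq (by positivity)

/-- Outside the Keevash–Lifshitz range the density is not small: `⅛ log(1/ν) < 2κ` gives `√ν ≤ ν·e^{8κ}`. [cite: KeevashLifshitz2023, Thm. 1.8] -/
theorem sqrt_le_mul_exp_pow {ν : ℝ} {κ : ℕ} (hν0 : 0 < ν) (h : Real.log (1 / ν) / 8 < ((2 * κ : ℕ) : ℝ)) :
    Real.sqrt ν ≤ ν * Real.exp 8 ^ κ := by
  have h1 : Real.log (1 / ν) < 16 * κ := by push_cast at h; linarith
  have h2 : 1 / ν < Real.exp (16 * κ) := by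
    calc 1 / ν = Real.exp (Real.log (1 / ν)) := (Real.exp_log (by positivity)).symm
      _ < Real.exp (16 * κ) := Real.exp_lt_exp.2 h1
  have h3 : 1 ≤ ν * Real.exp (16 * κ) := by
    rw [div_lt_iff₀ hν0] at h2
    linarith
  have he : Real.exp 8 ^ κ = Real.exp (8 * κ) := by
    rw [← Real.exp_nat_mul]; ring_nf
  rw [he, show ν * Real.exp (8 * κ) = Real.sqrt ((ν * Real.exp (8 * κ)) ^ 2) from (Real.sqrt_sq (by positivity)).symm]
  apply Real.sqrt_le_sqrt
  calc ν = ν * 1 := (mul_one ν).symm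
    _ ≤ ν * (ν * Real.exp (16 * κ)) := mul_le_mul_of_nonneg_left h3 hν0.le
    _ = (ν * Real.exp (8 * κ)) ^ 2 := by
        rw [show (16 : ℝ) * κ = 8 * κ + 8 * κ by ring, Real.exp_add]; ring

/-- `e⁸ ≤ 6561 = 3⁸`. [folklore] -/
theorem exp_eight_le : Real.exp 8 ≤ 6561 := by
  have h : Real.exp 8 = Real.exp 1 ^ 8 := by rw [← Real.exp_nat_mul]; norm_num
  rw [h]
  calc Real.exp 1 ^ 8 ≤ 3 ^ 8 := pow_le_pow_left₀ (Real.exp_pos 1).le Real.exp_one_lt_three.le 8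
    _ = 6561 := by norm_num

/-- `e^{2ℓ} ≤ 9^D` for `0 ≤ ℓ ≤ D`. [folklore] -/
theorem exp_two_mul_le_nine_pow {ℓ : ℝ} {D : ℕ} (hℓ : ℓ ≤ D) : Real.exp (2 * ℓ) ≤ 9 ^ D := by
  have h1 : Real.exp (2 * ℓ) ≤ Real.exp (2 * D) := Real.exp_le_exp.2 (by linarith)
  have h2 : Real.exp (2 * D) = (Real.exp 1 ^ 2) ^ D := by
    rw [← pow_mul, ← Real.exp_nat_mul]; push_cast; ring_nf
  have h3 : Real.exp 1 ^ 2 ≤ 9 := by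
    calc Real.exp 1 ^ 2 ≤ 3 ^ 2 := pow_le_pow_left₀ (Real.exp_pos 1).le Real.exp_one_lt_three.le 2
      _ = 9 := by norm_num
  calc Real.exp (2 * ℓ) ≤ (Real.exp 1 ^ 2) ^ D := h1.trans_eq h2
    _ ≤ 9 ^ D := pow_le_pow_left₀ (by positivity) h3 D

/-- Densities: from `e^{−ℓ} ≤ μ ≤ 1` we get `0 < μ` and `0 ≤ log(1/μ) ≤ ℓ`. [folklore] -/
theorem log_inv_le_of_exp_neg_le {μ ℓ : ℝ} (hμ : Real.exp (-ℓ) ≤ μ) (hμ1 : μ ≤ 1) :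
    0 < μ ∧ 0 ≤ Real.log (1 / μ) ∧ Real.log (1 / μ) ≤ ℓ := by
  have hpos : 0 < μ := (Real.exp_pos _).trans_le hμ
  refine ⟨hpos, Real.log_nonneg (by rw [le_div_iff₀ hpos, one_mul]; exact hμ1), ?_⟩
  rw [Real.log_le_iff_le_exp (by positivity), div_le_iff₀ hpos]
  have h := mul_le_mul_of_nonneg_left hμ (Real.exp_pos ℓ).le
  rw [← Real.exp_add, add_neg_cancel, Real.exp_zero] at h
  exact h

/-! ### §2 The head terms `κ ≤ dq n + 8`: every one is `≤ 4μν·16^{−κ}` (real-variable form) -/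

set_option maxHeartbeats 400000 in
/-- **Head term bound (real-variable form).** Let `C > 0`, `τ ≥ 1`, `0 < c₀ ≤ min(1, 1/(2736 C τ²))`, `D ≥ 2·10⁸` with `D⁴ ≤ n`,
`1 ≤ κ ≤ D + 8`, densities `e^{−c₀D} ≤ μ, ν ≤ 1`, an attenuation `0 ≤ A ≤ (4κ/n)^κ`, a normalised layer norm `0 ≤ L ≤ 16μ²F^{2κ}` with
`F = 48e(2 log(1/μ)/(2κ) + 3)` (the slice level-`2κ` inequality), and a quantity `T` obeying the Keevash–Lifshitz form
`|T| ≤ P·ν·(Cτ² log(1/ν)/(2κ))^κ·√(A·L)` whenever `2κ ≤ min(⅛ log(1/ν), 10⁻⁵ n)` and the Parseval form `|T| ≤ P·√(ν·A·L)` always (`P > 0`).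
Then `|T|/P ≤ 4μν·16^{−κ}`. [cite: KeevashLifshitz2023, Thm. 1.8] [cite: ODonnell2014, §9.5] [cite: Rothvoss2017, §2 (PDF p. 6)] -/
theorem head_term_abstract {C τ c₀ μ ν A L T P : ℝ} {n κ D : ℕ} (hC : 0 < C) (hτ : 1 ≤ τ) (hc₀0 : 0 < c₀) (hc₀1 : c₀ ≤ 1)
    (hc₀C : c₀ ≤ 1 / (2736 * C * τ ^ 2)) (hD : 2 * 10 ^ 8 ≤ D) (hD4n : D ^ 4 ≤ n) (hκ1 : 1 ≤ κ) (hκD : κ ≤ D + 8)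
    (hP : 0 < P) (hA : A ≤ ((4 * κ : ℝ) / n) ^ κ) (hL0 : 0 ≤ L)
    (hL : L ≤ 16 * μ ^ 2 * (48 * (Real.exp 1 * (2 * Real.log (1 / μ) / ((2 * κ : ℕ) : ℝ) + 3))) ^ (2 * κ))
    (hμ : Real.exp (-(c₀ * D)) ≤ μ) (hμ1 : μ ≤ 1) (hν : Real.exp (-(c₀ * D)) ≤ ν) (hν1 : ν ≤ 1)
    (hTK : ((2 * κ : ℕ) : ℝ) ≤ Real.log (1 / ν) / 8 → ((2 * κ : ℕ) : ℝ) ≤ (n : ℝ) / 10 ^ 5 →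
      |T| ≤ P * (ν * (C * τ ^ 2 * (1 / ((2 * κ : ℕ) : ℝ)) * Real.log (1 / ν)) ^ κ * Real.sqrt (A * L)))
    (hTP : |T| ≤ P * Real.sqrt (ν * (A * L))) :
    |T| / P ≤ 4 * μ * ν * (1 / 16) ^ κ := by
  obtain ⟨hμ0, hlμ0, hlμ⟩ := log_inv_le_of_exp_neg_le hμ hμ1
  obtain ⟨hν0, hlν0, hlν⟩ := log_inv_le_of_exp_neg_le hν hν1
  have hD4 : (D : ℝ) ^ 4 ≤ n := by exact_mod_cast hD4n
  have hDpos : (0 : ℝ) < D := by exact_mod_cast (show 0 < D by omega)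
  have hDge : (2 * 10 ^ 8 : ℝ) ≤ D := by exact_mod_cast hD
  have hDD : (2 * 10 ^ 8 : ℝ) * D ≤ (D : ℝ) * D := mul_le_mul_of_nonneg_right hDge hDpos.le
  have hD2 : (D : ℝ) * D ≤ (D : ℝ) ^ 4 := by
    have h1 : (1 : ℝ) ≤ (D : ℝ) * D := by nlinarith
    calc (D : ℝ) * D = (D : ℝ) * D * 1 := (mul_one _).symm
      _ ≤ (D : ℝ) * D * ((D : ℝ) * D) := mul_le_mul_of_nonneg_left h1 (by positivity)
      _ = (D : ℝ) ^ 4 := by ring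
  have hn0 : (0 : ℝ) < n := by
    have : (0 : ℝ) < (D : ℝ) ^ 4 := by positivity
    linarith
  have hℓ0 : 0 ≤ c₀ * D := by positivity
  have hℓD : c₀ * D ≤ D := by nlinarith
  have hκpos : (0 : ℝ) < κ := by exact_mod_cast hκ1
  have hκD' : (κ : ℝ) ≤ D + 8 := by exact_mod_cast hκD
  -- the head parameter `Φ = 2κF/D² = 96e(log(1/μ) + 3κ)/D²`
  set F : ℝ := 48 * (Real.exp 1 * (2 * Real.log (1 / μ) / ((2 * κ : ℕ) : ℝ) + 3)) with hF
  have hF0 : 0 ≤ F := by rw [hF]; positivity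
  set Φ : ℝ := 2 * κ * F / (D : ℝ) ^ 2 with hΦ
  have hΦ0 : 0 ≤ Φ := by rw [hΦ]; positivity
  have haF : (4 * κ : ℝ) / n * F ^ 2 ≤ Φ ^ 2 := by
    have h1 : (D : ℝ) ^ 4 ≤ κ * n := by
      calc (D : ℝ) ^ 4 ≤ n := hD4
        _ = 1 * n := (one_mul _).symm
        _ ≤ κ * n := mul_le_mul_of_nonneg_right (by exact_mod_cast hκ1) hn0.le
    have hD4pos : (0 : ℝ) < (D : ℝ) ^ 4 := by positivity
    have e : Φ ^ 2 = (4 * κ * F ^ 2) * (κ / (D : ℝ) ^ 4) := by rw [hΦ]; field_simp; ring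
    have e2 : (4 * κ : ℝ) / n * F ^ 2 = (4 * κ * F ^ 2) * (1 / n) := by ring
    rw [e, e2]
    refine mul_le_mul_of_nonneg_left ?_ (by positivity)
    rw [div_le_div_iff₀ hn0 hD4pos, one_mul]
    exact h1
  have hsq : Real.sqrt (A * L) ≤ 4 * μ * Φ ^ κ := sqrt_mul_le_of_layer hA (by positivity) hL0 hL hμ0.le hΦ0 haF
  have hΦeq : Φ = 96 * Real.exp 1 * (Real.log (1 / μ) + 3 * κ) / (D : ℝ) ^ 2 := by
    rw [hΦ, hF]; push_cast; field_simp; ring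
  by_cases hKL : ((2 * κ : ℕ) : ℝ) ≤ Real.log (1 / ν) / 8
  · -- inside the Keevash–Lifshitz range
    have hn5 : ((2 * κ : ℕ) : ℝ) ≤ (n : ℝ) / 10 ^ 5 := by
      rw [le_div_iff₀ (by norm_num)]
      push_cast
      nlinarith
    have hTb := hTK hKL hn5
    have hG0 : 0 ≤ C * τ ^ 2 * (1 / ((2 * κ : ℕ) : ℝ)) * Real.log (1 / ν) := by positivity
    -- `16κ ≤ ℓ`, hence `F ≤ 171 ℓ/κ` and `GΦ ≤ 171 C τ² c₀² ≤ 1/16`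
    have h16κ : 16 * (κ : ℝ) ≤ c₀ * D := by push_cast at hKL; linarith
    have hFle : F ≤ 171 * (c₀ * D) / κ := by
      rw [hF]
      have e1 : 2 * Real.log (1 / μ) / ((2 * κ : ℕ) : ℝ) = Real.log (1 / μ) / κ := by
        push_cast; field_simp
      rw [e1]
      have h2 : Real.log (1 / μ) / κ ≤ c₀ * D / κ := div_le_div_of_nonneg_right hlμ hκpos.le
      have h3 : (3 : ℝ) ≤ 3 * (c₀ * D) / (16 * κ) := by
        rw [le_div_iff₀ (by positivity)]; linarith
      have h4 : Real.exp 1 * (Real.log (1 / μ) / κ + 3) ≤ 3 * (c₀ * D / κ + 3 * (c₀ * D) / (16 * κ)) :=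
        mul_le_mul Real.exp_one_lt_three.le (by linarith) (by positivity) (by norm_num)
      calc 48 * (Real.exp 1 * (Real.log (1 / μ) / κ + 3)) ≤ 48 * (3 * (c₀ * D / κ + 3 * (c₀ * D) / (16 * κ))) := by
            linarith
        _ = 171 * (c₀ * D) / κ := by field_simp; ring
    have hGΦ : C * τ ^ 2 * (1 / ((2 * κ : ℕ) : ℝ)) * Real.log (1 / ν) * Φ ≤ 1 / 16 := by
      have e1 : C * τ ^ 2 * (1 / ((2 * κ : ℕ) : ℝ)) * Real.log (1 / ν) * Φ = C * τ ^ 2 * Real.log (1 / ν) * F / (D : ℝ) ^ 2 := by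
        rw [hΦ]; push_cast; field_simp
      rw [e1]
      calc C * τ ^ 2 * Real.log (1 / ν) * F / (D : ℝ) ^ 2
          ≤ C * τ ^ 2 * (c₀ * D) * (171 * (c₀ * D) / κ) / (D : ℝ) ^ 2 := by gcongr
        _ ≤ C * τ ^ 2 * (c₀ * D) * (171 * (c₀ * D) / 1) / (D : ℝ) ^ 2 := by
            gcongr
            exact_mod_cast hκ1
        _ = 171 * C * τ ^ 2 * c₀ * c₀ := by field_simp
        _ ≤ 171 * C * τ ^ 2 * c₀ * (1 / (2736 * C * τ ^ 2)) := by gcongr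
        _ = c₀ / 16 := by field_simp; ring
        _ ≤ 1 / 16 := by gcongr
    calc |T| / P ≤ ν * (C * τ ^ 2 * (1 / ((2 * κ : ℕ) : ℝ)) * Real.log (1 / ν)) ^ κ * Real.sqrt (A * L) := by
          rw [div_le_iff₀ hP]; linarith
      _ ≤ ν * (C * τ ^ 2 * (1 / ((2 * κ : ℕ) : ℝ)) * Real.log (1 / ν)) ^ κ * (4 * μ * Φ ^ κ) :=
          mul_le_mul_of_nonneg_left hsq (by positivity)
      _ = 4 * μ * ν * (C * τ ^ 2 * (1 / ((2 * κ : ℕ) : ℝ)) * Real.log (1 / ν) * Φ) ^ κ := by rw [mul_pow]; ring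
      _ ≤ 4 * μ * ν * (1 / 16) ^ κ := by
          have h0 : 0 ≤ C * τ ^ 2 * (1 / ((2 * κ : ℕ) : ℝ)) * Real.log (1 / ν) * Φ := mul_nonneg hG0 hΦ0
          gcongr
  · -- outside the range: `√ν ≤ ν e^{8κ}`
    push Not at hKL
    have hsν := sqrt_le_mul_exp_pow hν0 hKL
    have he8Φ : Real.exp 8 * Φ ≤ 1 / 16 := by
      rw [hΦeq]
      have h1 : Real.log (1 / μ) + 3 * κ ≤ 4 * D + 24 := by linarith
      have h2 : 96 * Real.exp 1 * (Real.log (1 / μ) + 3 * κ) ≤ 96 * 3 * (4 * D + 24) :=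
        mul_le_mul (by linarith [Real.exp_one_lt_three.le]) h1 (by positivity) (by positivity)
      calc Real.exp 8 * (96 * Real.exp 1 * (Real.log (1 / μ) + 3 * κ) / (D : ℝ) ^ 2)
          ≤ 6561 * (96 * 3 * (4 * D + 24) / (D : ℝ) ^ 2) :=
            mul_le_mul exp_eight_le (div_le_div_of_nonneg_right h2 (by positivity)) (by positivity) (by norm_num)
        _ = 1889568 * (4 * D + 24) / (D : ℝ) ^ 2 := by ring
        _ ≤ 1 / 16 := by
            rw [div_le_div_iff₀ (by positivity) (by norm_num), sq]
            linarith
    calc |T| / P ≤ Real.sqrt (ν * (A * L)) := by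
          rw [div_le_iff₀ hP]; linarith
      _ = Real.sqrt ν * Real.sqrt (A * L) := Real.sqrt_mul hν0.le _
      _ ≤ (ν * Real.exp 8 ^ κ) * (4 * μ * Φ ^ κ) := mul_le_mul hsν hsq (Real.sqrt_nonneg _) (by positivity)
      _ = 4 * μ * ν * (Real.exp 8 * Φ) ^ κ := by rw [mul_pow]; ring
      _ ≤ 4 * μ * ν * (1 / 16) ^ κ := by
          have h0 : 0 ≤ Real.exp 8 * Φ := mul_nonneg (Real.exp_pos 8).le hΦ0
          gcongr

/-! ### §3 The tail sum -/

/-- **Tail sum arithmetic**: with `m = dq n + 9`, `dq n ≥ 45`, `2t ≤ n` and `μ, ν ≥ exp(−c₀ dq n)` (`c₀ ≤ 1`):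
`c'·√(μν·A_m) ≤ μν/4` (because `16 c'² A_m ≤ 256 m² (4m/(dq n)⁴)^{m−2} ≤ 9^{−dq n} ≤ e^{−2c₀ dq n} ≤ μν`). [cite: GodsilMeagher2015, §15.2] -/
theorem tail_sum_arith {μ ν c₀ : ℝ} {c' : ℕ} (hD : 45 ≤ dq n) (ht : 2 * (2 * c' + 1) ≤ n) (hc₀1 : c₀ ≤ 1)
    (hμ : Real.exp (-(c₀ * dq n)) ≤ μ) (hν : Real.exp (-(c₀ * dq n)) ≤ ν) :
    (c' : ℝ) * Real.sqrt (μ * ν * ∏ i ∈ range (dq n + 9), ((2 * i + 1 : ℝ) / ((n : ℝ) - 2 * i))) ≤ μ * ν / 4 := by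
  set D : ℕ := dq n with hDdef
  set A : ℝ := ∏ i ∈ range (D + 9), ((2 * i + 1 : ℝ) / ((n : ℝ) - 2 * i)) with hA
  have hD4n : D ^ 4 ≤ n := by
    have h1 : dq n * dq n ≤ Nat.sqrt n := Nat.sqrt_le (Nat.sqrt n)
    calc D ^ 4 = (dq n * dq n) * (dq n * dq n) := by rw [hDdef]; ring
      _ ≤ Nat.sqrt n * Nat.sqrt n := Nat.mul_le_mul h1 h1
      _ ≤ n := Nat.sqrt_le n
  have hD2 : D * D ≤ D ^ 4 := by
    calc D * D = D * D * 1 := (mul_one _).symm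
      _ ≤ D * D * (D * D) := Nat.mul_le_mul_left _ (Nat.one_le_iff_ne_zero.2 (by positivity))
      _ = D ^ 4 := by ring
  have h4m : 4 * (D + 9) ≤ n := by
    have : 4 * (D + 9) ≤ D * D := by nlinarith
    omega
  have hμ0 : 0 < μ := (Real.exp_pos _).trans_le hμ
  have hν0 : 0 < ν := (Real.exp_pos _).trans_le hν
  have hA0 : 0 ≤ A := atten_nonneg (by omega)
  have hAle : A ≤ ((4 * (D + 9 : ℕ) : ℝ) / n) ^ (D + 9) := by
    have := atten_le_pow (n := n) h4m; push_cast at this ⊢; exact this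
  have hn0 : (0 : ℝ) < n := by exact_mod_cast (show 0 < n by omega)
  have hDpos : (0 : ℝ) < D := by exact_mod_cast (show 0 < D by omega)
  have hD4 : (D : ℝ) ^ 4 ≤ n := by exact_mod_cast hD4n
  have hDge : (45 : ℝ) ≤ D := by exact_mod_cast hD
  have hc'n : (c' : ℝ) ≤ n := by exact_mod_cast (show c' ≤ n by omega)
  -- `x = 4m/n ≤ x' = 4m/D⁴ ≤ min(1/9, 1/D²)`
  set x : ℝ := (4 * (D + 9 : ℕ) : ℝ) / n with hx
  set x' : ℝ := (4 * (D + 9 : ℕ) : ℝ) / (D : ℝ) ^ 4 with hx'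
  have hx0 : 0 ≤ x := by positivity
  have hxx' : x ≤ x' := by
    rw [hx, hx']; exact div_le_div_of_nonneg_left (by positivity) (by positivity) hD4
  have hDsq : (4 : ℝ) * ((D : ℝ) + 9) * 9 ≤ (D : ℝ) ^ 2 := by nlinarith [mul_nonneg (sub_nonneg.2 hDge) hDpos.le]
  have hD24 : (D : ℝ) ^ 2 ≤ (D : ℝ) ^ 4 := pow_le_pow_right₀ (by linarith) (by norm_num)
  have hx'9 : x' ≤ 1 / 9 := by
    rw [hx', div_le_div_iff₀ (by positivity) (by norm_num)]; push_cast; linarith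
  have hx'D : x' ≤ 1 / (D : ℝ) ^ 2 := by
    rw [hx', div_le_div_iff₀ (by positivity) (by positivity)]; push_cast
    have h1 : (4 : ℝ) * ((D : ℝ) + 9) ≤ (D : ℝ) ^ 2 := by nlinarith [mul_nonneg (sub_nonneg.2 hDge) hDpos.le]
    calc 4 * ((D : ℝ) + 9) * (D : ℝ) ^ 2 ≤ (D : ℝ) ^ 2 * (D : ℝ) ^ 2 := mul_le_mul_of_nonneg_right h1 (by positivity)
      _ = 1 * (D : ℝ) ^ 4 := by ring
  have hx'0 : 0 ≤ x' := hx0.trans hxx'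
  -- `16 c'² A ≤ 256 m² x'^{m−2}`
  have key1 : 16 * (c' : ℝ) ^ 2 * A ≤ 256 * ((D + 9 : ℕ) : ℝ) ^ 2 * x' ^ (D + 7) := by
    have e1 : ((4 * (D + 9 : ℕ) : ℝ) / n) ^ (D + 9) = x ^ 2 * x ^ (D + 7) := by
      rw [hx, ← pow_add, show 2 + (D + 7) = D + 9 by omega]
    have e2 : 16 * (c' : ℝ) ^ 2 * (x ^ 2 * x ^ (D + 7)) = 256 * ((D + 9 : ℕ) : ℝ) ^ 2 * ((c' : ℝ) / n) ^ 2 * x ^ (D + 7) := by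
      rw [hx]; field_simp; ring
    have hcn : ((c' : ℝ) / n) ^ 2 ≤ 1 := by
      apply pow_le_one₀ (by positivity); rw [div_le_one hn0]; exact hc'n
    calc 16 * (c' : ℝ) ^ 2 * A ≤ 16 * (c' : ℝ) ^ 2 * (x ^ 2 * x ^ (D + 7)) := by
          rw [← e1]; exact mul_le_mul_of_nonneg_left hAle (by positivity)
      _ = 256 * ((D + 9 : ℕ) : ℝ) ^ 2 * ((c' : ℝ) / n) ^ 2 * x ^ (D + 7) := e2
      _ ≤ 256 * ((D + 9 : ℕ) : ℝ) ^ 2 * 1 * x' ^ (D + 7) := by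
          gcongr
      _ = 256 * ((D + 9 : ℕ) : ℝ) ^ 2 * x' ^ (D + 7) := by ring
  -- `256 m² x'^{D+7} ≤ 9^{−D}` and `9^{−D} ≤ e^{−2ℓ} ≤ μν`
  have key2 : 256 * ((D + 9 : ℕ) : ℝ) ^ 2 * x' ^ (D + 7) ≤ ((1 : ℝ) / 9) ^ D := by
    have h1 : x' ^ (D + 7) ≤ (1 / 9) ^ D * (1 / (D : ℝ) ^ 2) ^ 7 := by
      rw [pow_add]
      exact mul_le_mul (pow_le_pow_left₀ hx'0 hx'9 D) (pow_le_pow_left₀ hx'0 hx'D 7) (by positivity) (by positivity)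
    have h2 : 256 * ((D + 9 : ℕ) : ℝ) ^ 2 * (1 / (D : ℝ) ^ 2) ^ 7 ≤ 1 := by
      rw [div_pow, one_pow, ← pow_mul, show 2 * 7 = 14 by rfl, mul_one_div, div_le_one (by positivity)]
      push_cast
      have h3 : ((D : ℝ) + 9) ^ 2 ≤ 4 * (D : ℝ) ^ 2 := by nlinarith
      have h4 : (1024 : ℝ) ≤ (D : ℝ) ^ 12 := by
        calc (1024 : ℝ) ≤ 45 ^ 12 := by norm_num
          _ ≤ (D : ℝ) ^ 12 := pow_le_pow_left₀ (by norm_num) hDge 12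
      calc 256 * ((D : ℝ) + 9) ^ 2 ≤ 256 * (4 * (D : ℝ) ^ 2) := by linarith
        _ = 1024 * (D : ℝ) ^ 2 := by ring
        _ ≤ (D : ℝ) ^ 12 * (D : ℝ) ^ 2 := mul_le_mul_of_nonneg_right h4 (by positivity)
        _ = (D : ℝ) ^ 14 := by ring
    calc 256 * ((D + 9 : ℕ) : ℝ) ^ 2 * x' ^ (D + 7) ≤ 256 * ((D + 9 : ℕ) : ℝ) ^ 2 * ((1 / 9) ^ D * (1 / (D : ℝ) ^ 2) ^ 7) :=
          mul_le_mul_of_nonneg_left h1 (by positivity)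
      _ = (1 / 9) ^ D * (256 * ((D + 9 : ℕ) : ℝ) ^ 2 * (1 / (D : ℝ) ^ 2) ^ 7) := by ring
      _ ≤ (1 / 9) ^ D * 1 := mul_le_mul_of_nonneg_left h2 (by positivity)
      _ = (1 / 9) ^ D := mul_one _
  have key3 : ((1 : ℝ) / 9) ^ D ≤ μ * ν := by
    have h9 := exp_two_mul_le_nine_pow (ℓ := c₀ * D) (D := D) (by nlinarith)
    have hexp : Real.exp (-(c₀ * D)) * Real.exp (-(c₀ * D)) ≤ μ * ν :=
      mul_le_mul hμ hν (Real.exp_pos _).le hμ0.le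
    rw [← Real.exp_add, show -(c₀ * (D : ℝ)) + -(c₀ * D) = -(2 * (c₀ * D)) by ring, Real.exp_neg] at hexp
    calc ((1 : ℝ) / 9) ^ D = ((9 : ℝ) ^ D)⁻¹ := by rw [one_div, inv_pow]
      _ ≤ (Real.exp (2 * (c₀ * D)))⁻¹ := inv_anti₀ (Real.exp_pos _) h9
      _ ≤ μ * ν := hexp
  have key : 16 * (c' : ℝ) ^ 2 * A ≤ μ * ν := key1.trans (key2.trans key3)
  -- conclude
  have hμν : 0 ≤ μ * ν := by positivity
  calc (c' : ℝ) * Real.sqrt (μ * ν * A) = Real.sqrt ((c' : ℝ) ^ 2 * (μ * ν * A)) := by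
        rw [Real.sqrt_mul (sq_nonneg _), Real.sqrt_sq (Nat.cast_nonneg _)]
    _ ≤ Real.sqrt ((μ * ν / 4) ^ 2) := by
        apply Real.sqrt_le_sqrt
        calc (c' : ℝ) ^ 2 * (μ * ν * A) = (16 * (c' : ℝ) ^ 2 * A) * (μ * ν) / 16 := by ring
          _ ≤ (μ * ν) * (μ * ν) / 16 := by gcongr
          _ = (μ * ν / 4) ^ 2 := by ring
    _ = μ * ν / 4 := Real.sqrt_sq (by positivity)

end Summit.PneNP.PneNP.Theorems.ChebyshevTracialDesignSpectralNonTightnessEstimates
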